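import Summits.QuantumFields.GaugeBoot.TiltedLatticeGauge
import HarnessLib

/-!
# Tilted diagonal frames on a periodic lattice: the mirror, the height, links (gauge-boot, L3(σ) part 2)

HONEST FRAMING (cell `pub-gaugeboot`, page 1 of every file): the venture produces certified bounds
on lattice expectations at stated coupling, gauge group, dimension and torus size; NOT a mass gap,
NOT a continuum limit, NOT a string tension; NOT Yang–Mills-summit-bearing (barriers
`FixedCouplingUltralocality`, `PerturbativeInvisibility`).

Continuation of `TiltedLatticeGauge.lean` (Wilson theory on a periodic lattice: a finite additive
commutative site group `A` with marked translations `e : Fin d → A`). This module isolates the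
geometric structure behind diagonal reflection positivity on the 45°-TILTED periodic box of
Fröhlich–Israel–Lieb–Simon (J. Stat. Phys. 22 (1980) 297, §3): a **tilted diagonal frame**
`IsTiltedFrame e i j θ P v` consists of

* the mirror `θ : A →+ A`, an involution exchanging the translations `e i`, `e j` and fixing the
  others (the swap `x_i ↔ x_j`);
* the height `v : A →+ ZMod (2P)` (`v = x_i - x_j mod 2P`, `P ≥ 2`): `v (e i) = 1`, `v (e j) = -1`,
  `v (e k) = 0` otherwise, `v ∘ θ = -v`;
* the KEY AXIOM `fix_of_layer`: every site of the two layers `v = 0` and `v = P` is FIXED by `θ`.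

On the cubic torus `(ℤ/L)^d` (`v = x_i - x_j mod L`, `L` even, `P = L/2`) the last axiom fails —
the back layer `v = L/2` is mapped to itself but not pointwise (`DiagonalRPTorusNegative.lean`,
`exists_layer_edges`), and diagonal RP is false there; on the tilted box
`ℤ^d / {2M_u ∣ x_i + x_j, 2M_v ∣ x_i - x_j, L ∣ x_k}` it holds because
`x - θx = (x_i - x_j)(e_i - e_j)` is a period as soon as `M_v ∣ x_i - x_j` (`TiltedBox.lean`).

Contents (all elementary; no measure theory): `ZMod` height arithmetic (`val` of `c ± 1`, `-c`);
the link involution `linkSwap (x, k) = (θx, (i j) k)` and the configuration involution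
`configSwap U = U ∘ linkSwap`; the closed half `{0 ≤ v ≤ P}` (`InHalf`), its links (`IsHalfLink`:
both endpoints in the closed half), the two layers (`IsLayer`), MIRROR links (`IsMirrorLink`: inside
a layer, direction `∉ {i, j}` — fixed by `linkSwap`), POSITIVE links (`IsPosLink`: half links that
are not mirror links — carried OUT of the closed half by `linkSwap`, `not_isHalfLink_linkSwap`, the
place where `P ≥ 2` is used); half-space observables (`IsHalfObservable`). Plaquettes are treated in
`TiltedRPPlaquettes.lean`.

References: J. Fröhlich, R. Israel, E. H. Lieb, B. Simon, Comm. Math. Phys. 62 (1978) 1, Thm. 2.1,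
and J. Stat. Phys. 22 (1980) 297, §3; K. Osterwalder, E. Seiler, Ann. Phys. 110 (1978) 440, §2;
V. Kazakov, Z. Zheng, arXiv:2203.11360 §3.1 (the diagonal RP family).
-/

namespace Summit.QuantumFields.GaugeBoot

namespace TiltedRP

/-! ## Height arithmetic in `ZMod (2P)` -/

section Height

variable {P : ℕ}

/-- `2P ≠ 0` for `P ≥ 2`. -/
theorem neZero_two_mul (hP : 2 ≤ P) : NeZero (2 * P) := ⟨by omega⟩

/-- The value of a height is `< 2P`. -/
theorem val_lt_two_mul (hP : 2 ≤ P) (c : ZMod (2 * P)) : c.val < 2 * P := by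
  haveI := neZero_two_mul hP
  exact ZMod.val_lt c

/-- `val 1 = 1` in `ZMod (2P)`, `P ≥ 2`. -/
theorem val_one_eq (hP : 2 ≤ P) : (1 : ZMod (2 * P)).val = 1 := by
  haveI : Fact (1 < 2 * P) := ⟨by omega⟩
  exact ZMod.val_one (2 * P)

/-- `val (P : ZMod 2P) = P`. -/
theorem val_natCast_self (hP : 2 ≤ P) : ((P : ℕ) : ZMod (2 * P)).val = P := by
  rw [ZMod.val_natCast]
  exact Nat.mod_eq_of_lt (by omega)

/-- `c = 0 ↔ val c = 0`. -/
theorem eq_zero_iff_val (c : ZMod (2 * P)) : c = 0 ↔ c.val = 0 := (ZMod.val_eq_zero c).symm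

/-- `c = P ↔ val c = P`. -/
theorem eq_natCast_iff_val (hP : 2 ≤ P) (c : ZMod (2 * P)) : c = (P : ZMod (2 * P)) ↔ c.val = P := by
  haveI := neZero_two_mul hP
  constructor
  · intro h; rw [h, val_natCast_self hP]
  · intro h
    apply ZMod.val_injective (2 * P)
    rw [h, val_natCast_self hP]

/-- `val (c + 1)`: `c.val + 1`, wrapping to `0` at the top. -/
theorem val_add_one (hP : 2 ≤ P) (c : ZMod (2 * P)) :
    (c + 1).val = if c.val + 1 = 2 * P then 0 else c.val + 1 := by
  haveI := neZero_two_mul hP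
  rw [ZMod.val_add, val_one_eq hP]
  have hc := ZMod.val_lt c
  split_ifs with h
  · rw [h, Nat.mod_self]
  · exact Nat.mod_eq_of_lt (by omega)

/-- `val (-c)`: `0` for `c = 0`, `2P - c.val` otherwise. -/
theorem val_neg (hP : 2 ≤ P) (c : ZMod (2 * P)) :
    (-c).val = if c.val = 0 then 0 else 2 * P - c.val := by
  haveI := neZero_two_mul hP
  rw [ZMod.neg_val]
  by_cases h : c = 0
  · simp [h]
  · rw [if_neg h, if_neg (fun h' => h ((eq_zero_iff_val c).2 h'))]

/-- `val (c - 1)`: `c.val - 1`, wrapping to `2P - 1` at the bottom. -/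
theorem val_sub_one (hP : 2 ≤ P) (c : ZMod (2 * P)) :
    (c - 1).val = if c.val = 0 then 2 * P - 1 else c.val - 1 := by
  haveI := neZero_two_mul hP
  have hc := ZMod.val_lt c
  have h1 : (-1 : ZMod (2 * P)).val = 2 * P - 1 := by
    rw [val_neg hP, val_one_eq hP, if_neg (by omega)]
  rw [sub_eq_add_neg, ZMod.val_add, h1]
  split_ifs with h
  · rw [h, zero_add]; exact Nat.mod_eq_of_lt (by omega)
  · rw [show c.val + (2 * P - 1) = (c.val - 1) + 2 * P by omega, Nat.add_mod_right]
    exact Nat.mod_eq_of_lt (by omega)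

/-- `-(P : ZMod 2P) = P`. -/
theorem neg_natCast_self (P : ℕ) : -((P : ℕ) : ZMod (2 * P)) = (P : ZMod (2 * P)) := by
  rw [neg_eq_iff_add_eq_zero, ← Nat.cast_add, ← two_mul, ZMod.natCast_self]

end Height

/-! ## Tilted diagonal frames -/

variable {A : Type*} [AddCommGroup A] {d : ℕ}

/-- **A tilted diagonal frame** on the periodic lattice `(A, e)`: directions `i ≠ j`, the mirror
`θ` (additive involution with `θ (e k) = e ((i j) k)`), the half period `P ≥ 2` and the height
`v : A →+ ZMod (2P)` (`v (e i) = 1`, `v (e j) = -1`, `v (e k) = 0` for `k ∉ {i, j}`, `v ∘ θ = -v`)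
such that BOTH layers `v = 0` and `v = P` are pointwise fixed by `θ`. The 45°-tilted periodic box
of Fröhlich–Israel–Lieb–Simon carries one (`TiltedBox.lean`); the cubic torus does not. -/
structure IsTiltedFrame (e : Fin d → A) (i j : Fin d) (θ : A →+ A) (P : ℕ)
    (v : A →+ ZMod (2 * P)) : Prop where
  /-- The two directions are distinct. -/
  ne : i ≠ j
  /-- The half period is at least `2`. -/
  two_le : 2 ≤ P
  /-- The mirror exchanges `e i` and `e j` and fixes the other translations. -/
  map_e : ∀ k, θ (e k) = e (Equiv.swap i j k)
  /-- The mirror is an involution. -/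
  invol : ∀ x, θ (θ x) = x
  /-- The height increases by one along `e i`. -/
  height_left : v (e i) = 1
  /-- The height decreases by one along `e j`. -/
  height_right : v (e j) = -1
  /-- The height is constant along the other translations. -/
  height_other : ∀ k, k ≠ i → k ≠ j → v (e k) = 0
  /-- The mirror reverses the height. -/
  height_map : ∀ x, v (θ x) = -v x
  /-- KEY AXIOM: the two layers `v = 0` and `v = P` are pointwise fixed by the mirror. -/
  fix_of_layer : ∀ x, v x = 0 ∨ v x = (P : ZMod (2 * P)) → θ x = x

/-! ## The swap on links and configurations -/

/-- The link involution: `(x, k) ↦ (θx, (i j) k)` (no link is reversed). -/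
def linkSwap (i j : Fin d) (θ : A →+ A) (l : Link A d) : Link A d := (θ l.1, Equiv.swap i j l.2)

/-- The induced involution `Θ` of configurations, `(ΘU)(l) = U(linkSwap l)`. -/
def configSwap {G : Type*} (i j : Fin d) (θ : A →+ A) (U : Config A d G) : Config A d G :=
  fun l => U (linkSwap i j θ l)

/-- `linkSwap` on components. -/
@[simp] theorem linkSwap_mk (i j : Fin d) (θ : A →+ A) (x : A) (k : Fin d) :
    linkSwap i j θ (x, k) = (θ x, Equiv.swap i j k) := rfl

/-- `configSwap` evaluated. -/
@[simp] theorem configSwap_apply {G : Type*} (i j : Fin d) (θ : A →+ A) (U : Config A d G)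
    (l : Link A d) : configSwap i j θ U l = U (linkSwap i j θ l) := rfl

namespace IsTiltedFrame

variable {e : Fin d → A} {i j : Fin d} {θ : A →+ A} {P : ℕ} {v : A →+ ZMod (2 * P)}
variable (hF : IsTiltedFrame e i j θ P v)
include hF

/-- `θ (x + e k) = θ x + e ((i j) k)`. -/
theorem map_add_e (x : A) (k : Fin d) : θ (x + e k) = θ x + e (Equiv.swap i j k) := by
  rw [map_add, hF.map_e]

/-- `linkSwap` is an involution. -/
@[simp] theorem linkSwap_linkSwap (l : Link A d) : linkSwap i j θ (linkSwap i j θ l) = l := by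
  obtain ⟨x, k⟩ := l
  simp [hF.invol, Equiv.swap_apply_self]

/-- `linkSwap` is involutive. -/
theorem linkSwap_involutive : Function.Involutive (linkSwap (d := d) i j θ) :=
  hF.linkSwap_linkSwap

/-- `configSwap` is an involution. -/
theorem configSwap_configSwap {G : Type*} (U : Config A d G) :
    configSwap i j θ (configSwap i j θ U) = U := by
  funext l
  simp [hF.linkSwap_linkSwap]

/-! ## Heights of neighbours -/

/-- Height along `e i`: `v (x + e i) = v x + 1`. -/
theorem height_add_left (x : A) : v (x + e i) = v x + 1 := by rw [map_add, hF.height_left]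

/-- Height along `e j`: `v (x + e j) = v x - 1`. -/
theorem height_add_right (x : A) : v (x + e j) = v x - 1 := by
  rw [map_add, hF.height_right, sub_eq_add_neg]

/-- Height along `e k`, `k ∉ {i, j}`: unchanged. -/
theorem height_add_other (x : A) {k : Fin d} (hki : k ≠ i) (hkj : k ≠ j) : v (x + e k) = v x := by
  rw [map_add, hF.height_other k hki hkj, add_zero]

/-- `val` of the height along `e i`. -/
theorem val_height_add_left (x : A) :
    (v (x + e i)).val = if (v x).val + 1 = 2 * P then 0 else (v x).val + 1 := by
  rw [hF.height_add_left, val_add_one hF.two_le]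

/-- `val` of the height along `e j`. -/
theorem val_height_add_right (x : A) :
    (v (x + e j)).val = if (v x).val = 0 then 2 * P - 1 else (v x).val - 1 := by
  rw [hF.height_add_right, val_sub_one hF.two_le]

/-- `val` of the height of the mirror image. -/
theorem val_height_map (x : A) :
    (v (θ x)).val = if (v x).val = 0 then 0 else 2 * P - (v x).val := by
  rw [hF.height_map, val_neg hF.two_le]

/-- The layers in terms of `val`: `v x = 0 ∨ v x = P ↔ val = 0 ∨ val = P`. -/
theorem layer_iff_val (x : A) :
    (v x = 0 ∨ v x = (P : ZMod (2 * P))) ↔ ((v x).val = 0 ∨ (v x).val = P) := by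
  rw [eq_zero_iff_val, eq_natCast_iff_val hF.two_le]

/-- The mirror preserves the layers: `v (θ x) ∈ {0, P} ↔ v x ∈ {0, P}`. -/
theorem layer_map_iff (x : A) :
    (v (θ x) = 0 ∨ v (θ x) = (P : ZMod (2 * P))) ↔ (v x = 0 ∨ v x = (P : ZMod (2 * P))) := by
  rw [hF.height_map, neg_eq_zero, neg_eq_iff_eq_neg, neg_natCast_self]

end IsTiltedFrame

/-! ## The closed half, its links, the layers, mirror and positive links -/

section Links

variable (e : Fin d → A) (i j : Fin d) (P : ℕ) (v : A →+ ZMod (2 * P))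

/-- The closed half `{0 ≤ v ≤ P}` (heights read in `[0, 2P)`). -/
def InHalf (x : A) : Prop := (v x).val ≤ P

/-- A link of the closed half: both endpoints in `{0 ≤ v ≤ P}`. -/
def IsHalfLink (l : Link A d) : Prop := InHalf P v l.1 ∧ InHalf P v (l.1 + e l.2)

/-- A site of one of the two layers `v = 0`, `v = P`. -/
def IsLayer (x : A) : Prop := v x = 0 ∨ v x = (P : ZMod (2 * P))

/-- A MIRROR link: based in a layer, direction `∉ {i, j}` (so it lies inside the layer). -/
def IsMirrorLink (l : Link A d) : Prop := IsLayer P v l.1 ∧ l.2 ≠ i ∧ l.2 ≠ j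

/-- A POSITIVE link: a link of the closed half which is not a mirror link. -/
def IsPosLink (l : Link A d) : Prop := IsHalfLink e P v l ∧ ¬ IsMirrorLink i j P v l

/-- `F` is an observable of the closed half: it depends only on the links of the closed half. -/
def IsHalfObservable {G α : Type*} (F : Config A d G → α) : Prop :=
  ∀ U V : Config A d G, (∀ l, IsHalfLink e P v l → U l = V l) → F U = F V

end Links

namespace IsTiltedFrame

variable {e : Fin d → A} {i j : Fin d} {θ : A →+ A} {P : ℕ} {v : A →+ ZMod (2 * P)}
variable (hF : IsTiltedFrame e i j θ P v)
include hF

/-- Layer sites are fixed by the mirror. -/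
theorem map_of_isLayer {x : A} (hx : IsLayer P v x) : θ x = x := hF.fix_of_layer x hx

/-- Layer sites lie in the closed half. -/
theorem inHalf_of_isLayer {x : A} (hx : IsLayer P v x) : InHalf P v x := by
  have h := (hF.layer_iff_val x).1 hx
  have hP := hF.two_le
  unfold InHalf; omega

/-- **Mirror links are fixed by `linkSwap`.** -/
theorem linkSwap_of_isMirrorLink {l : Link A d} (hl : IsMirrorLink i j P v l) :
    linkSwap i j θ l = l := by
  obtain ⟨x, k⟩ := l
  obtain ⟨h1, h2, h3⟩ := hl
  simp only [linkSwap_mk, Prod.mk.injEq]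
  exact ⟨hF.map_of_isLayer h1, Equiv.swap_apply_of_ne_of_ne h2 h3⟩

/-- Mirror links are links of the closed half. -/
theorem isHalfLink_of_isMirrorLink {l : Link A d} (hl : IsMirrorLink i j P v l) :
    IsHalfLink e P v l := by
  obtain ⟨x, k⟩ := l
  obtain ⟨h1, h2, h3⟩ := hl
  refine ⟨hF.inHalf_of_isLayer h1, ?_⟩
  show InHalf P v (x + e k)
  unfold InHalf
  rw [hF.height_add_other x h2 h3]
  exact hF.inHalf_of_isLayer h1

/-- The links of the closed half are the positive links and the mirror links. -/
theorem isHalfLink_iff_pos_or_mirror (l : Link A d) :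
    IsHalfLink e P v l ↔ IsPosLink e i j P v l ∨ IsMirrorLink i j P v l := by
  constructor
  · intro h
    by_cases hm : IsMirrorLink i j P v l
    · exact Or.inr hm
    · exact Or.inl ⟨h, hm⟩
  · rintro (h | h)
    · exact h.1
    · exact hF.isHalfLink_of_isMirrorLink h

/-- **`linkSwap` carries positive links out of the closed half** (this is where `P ≥ 2` enters). -/
theorem not_isHalfLink_linkSwap {l : Link A d} (hl : IsPosLink e i j P v l) :
    ¬ IsHalfLink e P v (linkSwap i j θ l) := by
  obtain ⟨x, k⟩ := l
  obtain ⟨⟨h1, h2⟩, hm⟩ := hl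
  have hP := hF.two_le
  have hcx := val_lt_two_mul hP (v x)
  unfold InHalf at h1 h2
  simp only at h1 h2
  intro h'
  obtain ⟨h3, h4⟩ := h'
  unfold InHalf at h3 h4
  simp only [linkSwap_mk] at h3 h4
  rw [← hF.map_add_e] at h4
  rw [hF.val_height_map] at h3 h4
  by_cases hki : k = i
  · subst hki
    rw [hF.val_height_add_left] at h2 h4
    split_ifs at h2 h3 h4 <;> omega
  · by_cases hkj : k = j
    · subst hkj
      rw [hF.val_height_add_right] at h2 h4
      split_ifs at h2 h3 h4 <;> omega
    · rw [hF.height_add_other x hki hkj] at h4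
      apply hm
      refine ⟨(hF.layer_iff_val x).2 ?_, hki, hkj⟩
      split_ifs at h3 <;> omega

/-- A link of the closed half whose image is also in the closed half is a mirror link. -/
theorem isMirrorLink_of_isHalfLink_linkSwap {l : Link A d} (hl : IsHalfLink e P v l)
    (hl' : IsHalfLink e P v (linkSwap i j θ l)) : IsMirrorLink i j P v l := by
  by_contra hm
  exact hF.not_isHalfLink_linkSwap ⟨hl, hm⟩ hl'

omit hF in
/-- A half-space observable, restated as `DependsOn`: `F` depends only on the set of half links. -/
theorem dependsOn_of_isHalfObservable {G α : Type*} {F : Config A d G → α}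
    (hFo : IsHalfObservable e P v F) :
    DependsOn F {l | IsHalfLink e P v l} :=
  fun U V h => hFo U V fun l hl => h l hl

end IsTiltedFrame

end TiltedRP

end Summit.QuantumFields.GaugeBoot
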